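import Summits.Ventures.HodgeRepro2.T5SU11JacobiTransform

/-!
# The spherical transform as the Laplace transform of the Abel (horocycle) transform:
`∫_G f φ_λ dν = ∫_ℝ e^{λ t} (∫_ℝ f(a_t n_s) ds) dt` for bi-`K`-invariant `f`

The two steps of `T5SU11JacobiIwasawa` / `T5SU11JacobiTransform` are carried out for a GENERAL
continuous bi-`K`-invariant `f`: (1) the `K`-average in `φ_λ(g) = ∫_K e^{λ t(k g)} dk` is removed by Fubini
on `G × K` whenever `F = f e^{λ t} ∈ L¹(ν)` (`integral_mul_sph_eq_of_left_invariant`: the `G`-sections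
are left translates of `F`, the outer function is the constant `∫_G ‖F‖ dν`); (2) `ν = db dk` and
`borelHaar = ((s, t) ↦ a_t n_s)_*(ds dt)` turn the `ν`-integral of the right-`K`-invariant `F` into a
plane integral, with the integrability transferred along the measurable embeddings
(`integrable_comp_mulAN_of_integrable`), so that Fubini on `ℝ²` applies. Since `t(a_t n_s) = t`,
**`∫_G f φ_λ dν = ∫_ℝ e^{λ t} (∫_ℝ f(a_t n_s) ds) dt`** (`integral_mul_sph_eq_abel`): the spherical
transform of `f` is the (two-sided) Laplace transform of its horocycle integral — Harish-Chandra's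
factorisation through the Abel transform, in kernel for the explicit model; in the classical
normalisation `A f(t) = e^{t} ∫_N f(a_t n) dn`, `f̂(λ) = ∫_ℝ e^{(λ−1) t} A f(t) dt`
(`integral_mul_sph_eq_abel'`). For `f = m_k` this is the plane integral of `T5SU11JacobiIwasawa`
(`integral_orbit_rpow_mul_sph_eq_abel`). Nothing is claimed about (N).

Blind lane: Mathlib + the HodgeRepro2 prefix only; no sorry; axioms ⊆ {propext, Classical.choice,
Quot.sound}.
-/

namespace Summit.Ventures.HodgeRepro2.T5SU11AbelTransform

open MeasureTheory MeasureTheory.Measure Metric Set Filter Topology Complex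
open T5SU11Unimodular T5SU11Fibration T5SU11Cartan T5SU11OneParameter T5SU11CartanProjection
  T5HaarCircle T5BergmanCoefficient T5SU11FibrationHaar T5SU11UnipotentSubgroup
  T5SU11BorelSubgroup T5SU11BorelHaar T5SU11BorelHaarNA T5SU11HaarBK T5SU11IwasawaProjection
  T5SU11SphericalFunction T5SU11SphericalProduct T5SU11JacobiIwasawa T5SU11JacobiTransform
open scoped Real

section measure

variable [MeasurableSpace Circle] [BorelSpace Circle]

/-! ### Integrability transfer `G → B → ℝ²` for right-`K`-invariant functions -/

/-- A right-`K`-invariant `ν`-integrable function is `borelHaar`-integrable on `B`. -/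
theorem integrable_restrict_borel_of_integrable {F : SU11 → ℝ}
    (hK : ∀ (g : SU11) (u : Circle), F (g * rot u) = F g) (hF : Integrable F (nu haarCircle)) :
    Integrable (fun b : borelSubgroup => F (b : SU11)) borelHaar := by
  rw [nu_eq_map_mulBK, measurableEmbedding_mulBK.integrable_map_iff] at hF
  have e : (F ∘ mulBK) = fun p : borelSubgroup × Circle => F (p.1 : SU11) := by
    funext ⟨b, u⟩
    simp only [Function.comp_apply, mulBK_apply, hK]
  rw [e] at hF
  exact hF.of_comp_fst (NeZero.ne haarCircle)

/-- A right-`K`-invariant `ν`-integrable function is integrable on `ℝ²` in the `A N` chart. -/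
theorem integrable_comp_mulAN_of_integrable {F : SU11 → ℝ}
    (hK : ∀ (g : SU11) (u : Circle), F (g * rot u) = F g) (hF : Integrable F (nu haarCircle)) :
    Integrable (fun p : ℝ × ℝ => F (hyp p.2 * unip p.1)) ((volume : Measure ℝ).prod volume) := by
  have h := integrable_restrict_borel_of_integrable hK hF
  rw [borelHaar_eq_map_prod, measurableEmbedding_mulAN.integrable_map_iff] at h
  rw [← volume_eq_prod]
  exact h

/-! ### Removing the `K`-average -/

/-- **The `K`-average is removed for every left-`K`-invariant `f`**: if `f` is continuous,
`f (rot u · g) = f g`, and `F = f e^{λ t} ∈ L¹(ν)`, then `∫_G f φ_λ dν = ∫_G f e^{λ t} dν`. -/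
theorem integral_mul_sph_eq_of_left_invariant {f : SU11 → ℝ} (hf : Continuous f)
    (hK : ∀ (u : Circle) (g : SU11), f (rot u * g) = f g) {lam : ℝ}
    (hF : Integrable (fun g => f g * Real.exp (lam * iwasawaT g)) (nu haarCircle)) :
    ∫ g, f g * sph lam g ∂(nu haarCircle)
      = ∫ g, f g * Real.exp (lam * iwasawaT g) ∂(nu haarCircle) := by
  -- the integrand on `G × K`
  have hcont : Continuous fun p : SU11 × Circle => f p.1 * Real.exp (lam * iwasawaT (rot p.2 * p.1)) :=
    (hf.comp continuous_fst).mul (Real.continuous_exp.comp (continuous_const.mul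
      (continuous_iwasawaT.comp ((continuous_rot.comp continuous_snd).mul continuous_fst))))
  have htr : ∀ (u : Circle) (g : SU11), f g * Real.exp (lam * iwasawaT (rot u * g))
      = (fun h : SU11 => f h * Real.exp (lam * iwasawaT h)) (rot u * g) := by
    intro u g
    simp only [hK]
  have hint : Integrable (fun p : SU11 × Circle => f p.1 * Real.exp (lam * iwasawaT (rot p.2 * p.1)))
      ((nu haarCircle).prod haarCircle) := by
    refine (integrable_prod_iff' hcont.aestronglyMeasurable).mpr
      ⟨Filter.Eventually.of_forall fun u => ?_, ?_⟩
    · show Integrable (fun g : SU11 => f g * Real.exp (lam * iwasawaT (rot u * g))) (nu haarCircle)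
      simp_rw [htr]
      exact hF.comp_mul_left (rot u)
    · show Integrable (fun u : Circle => ∫ g, ‖f g * Real.exp (lam * iwasawaT (rot u * g))‖
        ∂(nu haarCircle)) haarCircle
      have e : (fun u : Circle => ∫ g, ‖f g * Real.exp (lam * iwasawaT (rot u * g))‖ ∂(nu haarCircle))
          = fun _ => ∫ g, ‖f g * Real.exp (lam * iwasawaT g)‖ ∂(nu haarCircle) := by
        funext u
        rw [← integral_mul_left_eq_self
          (fun g : SU11 => ‖f g * Real.exp (lam * iwasawaT g)‖) (rot u)]
        refine integral_congr_ae (Filter.Eventually.of_forall fun g => ?_)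
        beta_reduce
        rw [htr]
      rw [e]
      exact integrable_const _
  have e1 : ∫ g, f g * sph lam g ∂(nu haarCircle)
      = ∫ g, ∫ u, f g * Real.exp (lam * iwasawaT (rot u * g)) ∂haarCircle ∂(nu haarCircle) := by
    congr 1
    funext g
    rw [sph, integral_const_mul]
  rw [e1, ← integral_prod _ hint, integral_prod_symm _ hint]
  have e2 : ∀ u : Circle,
      ∫ g, f g * Real.exp (lam * iwasawaT (rot u * g)) ∂(nu haarCircle)
      = ∫ g, f g * Real.exp (lam * iwasawaT g) ∂(nu haarCircle) := by
    intro u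
    rw [← integral_mul_left_eq_self (fun g : SU11 => f g * Real.exp (lam * iwasawaT g)) (rot u)]
    refine integral_congr_ae (Filter.Eventually.of_forall fun g => ?_)
    beta_reduce
    rw [htr]
  simp_rw [e2]
  rw [integral_const, measureReal_def, haarCircle_univ, ENNReal.toReal_one, one_smul]

/-! ### The Abel factorisation -/

/-- **THE SPHERICAL TRANSFORM IS THE LAPLACE TRANSFORM OF THE HOROCYCLE INTEGRAL**: for a continuous
bi-`K`-invariant `f` with `f e^{λ t} ∈ L¹(ν)`,
`∫_G f φ_λ dν = ∫_ℝ e^{λ t} (∫_ℝ f(a_t n_s) ds) dt`. -/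
theorem integral_mul_sph_eq_abel {f : SU11 → ℝ} (hf : Continuous f)
    (hK : ∀ (u v : Circle) (g : SU11), f (rot u * g * rot v) = f g) {lam : ℝ}
    (hF : Integrable (fun g => f g * Real.exp (lam * iwasawaT g)) (nu haarCircle)) :
    ∫ g, f g * sph lam g ∂(nu haarCircle)
      = ∫ t : ℝ, Real.exp (lam * t) * ∫ s : ℝ, f (hyp t * unip s) := by
  have hL : ∀ (u : Circle) (g : SU11), f (rot u * g) = f g := fun u g => by
    simpa using hK u 1 g
  have hR : ∀ (g : SU11) (u : Circle), f (g * rot u) = f g := fun g u => by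
    simpa using hK 1 u g
  have hR' : ∀ (g : SU11) (u : Circle),
      f (g * rot u) * Real.exp (lam * iwasawaT (g * rot u)) = f g * Real.exp (lam * iwasawaT g) := by
    intro g u
    rw [hR, iwasawaT_mul_rot]
  rw [integral_mul_sph_eq_of_left_invariant hf hL hF, integral_nu_mulBK]
  -- `ν = db dk`, the integrand does not depend on `k`
  have e : (fun p : borelSubgroup × Circle =>
      f (mulBK p) * Real.exp (lam * iwasawaT (mulBK p)))
      = fun p => (f (p.1 : SU11) * Real.exp (lam * iwasawaT (p.1 : SU11))) * (1 : ℝ) := by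
    funext p
    rw [mul_one, mulBK_apply, hR']
  have h := integral_prod_mul (μ := borelHaar) (ν := haarCircle)
    (fun b : borelSubgroup => f (b : SU11) * Real.exp (lam * iwasawaT (b : SU11)))
    (fun _ : Circle => (1 : ℝ))
  beta_reduce at h
  rw [e, h, integral_const, measureReal_def, haarCircle_univ, ENNReal.toReal_one, one_smul, mul_one,
    integral_borelHaar_prod]
  -- the plane integral
  have hplane := integrable_comp_mulAN_of_integrable hR' hF
  have e2 : (fun p : ℝ × ℝ => f (mulAN p : SU11) * Real.exp (lam * iwasawaT (mulAN p : SU11)))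
      = fun p : ℝ × ℝ => f (hyp p.2 * unip p.1) * Real.exp (lam * p.2) := by
    funext p
    rw [coe_mulAN, iwasawaT_hyp_mul_unip]
  rw [e2, volume_eq_prod, integral_prod_symm _ (by simpa [coe_mulAN, iwasawaT_hyp_mul_unip] using hplane)]
  congr 1
  funext t
  show ∫ s : ℝ, f (hyp t * unip s) * Real.exp (lam * t) = _
  rw [integral_mul_const, mul_comm]

/-- **The classical normalisation**: with the Abel transform `A f(t) = e^{t} ∫_ℝ f(a_t n_s) ds`,
`∫_G f φ_λ dν = ∫_ℝ e^{(λ − 1) t} A f(t) dt`. -/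
theorem integral_mul_sph_eq_abel' {f : SU11 → ℝ} (hf : Continuous f)
    (hK : ∀ (u v : Circle) (g : SU11), f (rot u * g * rot v) = f g) {lam : ℝ}
    (hF : Integrable (fun g => f g * Real.exp (lam * iwasawaT g)) (nu haarCircle)) :
    ∫ g, f g * sph lam g ∂(nu haarCircle)
      = ∫ t : ℝ, Real.exp ((lam - 1) * t) * (Real.exp t * ∫ s : ℝ, f (hyp t * unip s)) := by
  rw [integral_mul_sph_eq_abel hf hK hF]
  congr 1
  funext t
  rw [← mul_assoc, ← Real.exp_add]
  congr 2
  ring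

/-- For `f = m_k` the Abel factorisation is the plane integral of `T5SU11JacobiIwasawa`:
`∫_G m_k φ_λ dν = ∫_ℝ e^{λ t} ∫_ℝ (cosh² t + s² e^{2t})^{-k/2} ds dt` (`k > 1`, `λ < k`, `k + λ > 2`). -/
theorem integral_orbit_rpow_mul_sph_eq_abel {k lam : ℝ} (hk : 1 < k) (h1 : lam < k)
    (h2 : 2 < k + lam) :
    ∫ g, (1 - ‖orbit g‖ ^ 2) ^ (k / 2) * sph lam g ∂(nu haarCircle)
      = ∫ t : ℝ, Real.exp (lam * t)
          * ∫ s : ℝ, (Real.cosh t ^ 2 + s ^ 2 * Real.exp (2 * t)) ^ (-(k / 2)) := by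
  rw [integral_mul_sph_eq_abel (continuous_orbit_rpow k)
    (fun u v g => by rw [T5SU11CoeffSqCartan.orbit_mul_rot, T5SU11CoeffSqCartan.norm_orbit_rot_mul])
    (integrable_orbit_rpow_mul_exp_iwasawaT hk h1 h2)]
  simp_rw [one_sub_norm_orbit_sq_rpow_hyp_mul_unip]

end measure

end Summit.Ventures.HodgeRepro2.T5SU11AbelTransform
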